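import Summits.Ventures.AbcSig.Rows.BridgeC2c
import Summits.Ventures.AbcSig.Rows.C2cL5

/-!
# Venture AbcSig — CELL `C2cL5`: p1's census predicate `Rows.C2cCell 5 ∅` from the C2c row (exponent reduction by `Rows/BridgeC2c.lean`)

HONEST FRAMING. COMPUTATION cell `pub-abcsig`; CONDITIONAL theorem; no claim on ABC or any summit. Hypotheses exactly as in
`Rows/C2cL5.lean`: `BS04Package` (CITED), `DataComplete 1280` / `RefinesCPSymAll 1280` (COMPUTED; norm-form certificates), the row's per-orbit
CITED exclusions universally quantified in `n` and `m`. Conclusion = the conjunct `Rows.C2cCell 5 ∅` of p1's `C2Part2Signed` /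
`C2Part2bSigned` (`Rows/Statements.lean`; row of record `census/rows/C2a/C2c-l5.md`): ALL `m ≥ 1` with `n ∤ m` and all
coprime distributions `A·B = 5^m` — obtained from the reduced rows (`m < n`) by `C2cCell_of_rows` (m ↦ m mod n, y ↦ ℓ^q·y).
-/

namespace Summit.Ventures.AbcSig

/-- Cell `C2cL5`: `Rows.C2cCell 5 ∅` under the row's hypotheses. -/
theorem xcell_C2cL5 (M : NewformModel) (hP : M.BS04Package)
    (hD1280 : M.DataComplete 1280 level1280Orbits) (hCP1280 : M.RefinesCPSymAll 1280 level1280CP)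
 :
    Rows.C2cCell 5 ∅ :=
  C2cCell_of_rows 5 (by norm_num) (by norm_num) _
    (fun n hn h11 hnℓ _ m hm hmn x y z h1 h2 =>
      xrow_C2cL5 M hP hD1280 hCP1280 n hn h11 hnℓ  m hm hmn  x y z h1 h2)

end Summit.Ventures.AbcSig
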